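import Summits.ResolutionOfSingularities.ResolutionOfSingularities.Theorems.EquisingularLiftEquisingularLiftNatResidueHypDefsE5
import Summits.ResolutionOfSingularities.ResolutionOfSingularities.Theorems.EquisingularLiftEquisingularLiftNatEquinodalHyperplaneLift
import Summits.ResolutionOfSingularities.ResolutionOfSingularities.Theorems.EquisingularLiftEquisingularLiftNatEquinodalHostNormalForm
import Mathlib.RingTheory.MvPolynomial.EulerIdentity
import HarnessLib

/-!
# EL♮(3), nose doors: THE CENSUS LEMMA «Σ1 ⊂ Σ5a BY TEXT» — every ν3ᵈ move (door `ReachDirectPlanarNose₂`, ✓ p703167) IS a ν3ᶜⁱ move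
# (door `ReachDirectCINose₂`, ✓ p705365), at a linear non-zero host `ℓ`: `f₁ := ℓ`, `f₂ := g`

res-L1-w45b-nose-w1 g6 (WIDTH seat D-0157 DOOR 1, nose residue).  res-L1-w45b-idea-2's D11 sizing (`D11-CI-DIRECT-SIZING.md` cd5c664317da9e7f §0 (β),
§5) and the desk's RULING R72 (i)(2)(β) record «Σ1 ⊂ Σ5a at the level of customers and of letters, not as identical text» and therefore add ν3ᶜⁱ as
a THIRD disjunct of the 47th's blob.  This module is the BY-TEXT census lemma: for the blob's hyperplane host `E₀ = V₊(ℓ)` (`ℓ` homogeneous of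
degree `1`, `ℓ ≠ 0` — the blob's own binders) every instance of the planar door yields an instance of the ci door with the SAME `Z`, the same
direct round and the same B‴ tail, and the ci block `(d₁, d₂, f₁, f₂) := (1, e, ℓ, g)`:

* `IsRelPrime ℓ g` — a common divisor `d` of `ℓ` and `g`: `ℓ = d·q`; reading the hyperplane substitution `ψ = restrictToHyperplane B` (kernel
  `(L)`, section `σ`, ✓ `HyperplaneAlg.exists_hyperplane_section`) either `ψ d = 0 ⇒ L ∣ d ∣ g ⇒ g|_Π = 0`, impossible for a squarefree `g|_Π`,
  or `ψ q = 0 ⇒ L ∣ q ⇒ deg q ≥ 1 ⇒ deg d = 0 ⇒ d` a unit (`linearForm_isRelPrime_of_squarefree_restrict`);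
* `g ≠ 0` — `g|_Π ≠ 0` (`Squarefree`; inlined);
* `(ℓ, g)` RADICAL — `(L, σ(g|_Π))` is radical (✓ `HyperplaneAlg.isRadical_pair_of_isRadical` on the squarefree `g|_Π`), `ℓ = u·L` with `u ≠ 0`
  (✓ `HostNormalForm.exists_C_mul_eq_of_dvd`) and `g ≡ σ(g|_Π) mod L` (✓ `dvd_sub_section`), so the two pairs span the same ideal
  (`isRadical_span_linearForm_pair_of_squarefree_restrict`);
* (HOST-J) for a LINEAR form — some `∂ᵢℓ` is a non-zero constant (Euler), a unit outside every point (`exists_pderiv_notMem_of_isHomogeneous_one`).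

★ `reachDirectCINose₂_of_reachDirectPlanarNose₂` assembles them; the dropped letters of ν3ᵈ (`Z ⊆ V₊(ℓ)`, `IsPreirreducible Z`, ambient/host
regularity, host dimension) are simply not transported.  USE: honest residue wording — after the 47th the nose residue reads by text
«¬((ν4 ∨ ν3ᵈ) ∨ ν3ᶜⁱ)» with ν3ᵈ ⊆ ν3ᶜⁱ, i.e. it is «¬(ν4 ∨ ν3ᶜⁱ)» up to this lemma; a later count-neutral REPLACE may drop the ν3ᵈ disjunct
(rule hypothesis `(A ∨ B) ∨ C` with `B → C`) — the desk's call, not proposed here.  Pure algebra + logic; DEF-FREE; no `sorry`; standard axioms;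
`--supports stmt-ResolutionOfSingularities-20148 --as helper`, counted 0.  EL♮(3) is NOT proved; resolution of singularities in positive characteristic is
NOT proved anywhere in this tree; nothing of [Hironaka2017] is asserted.
-/

set_option linter.dupNamespace false -- mandated namespace `Summit.<Summit>.<Problem>` of this single-conjunct summit

noncomputable section

open CategoryTheory AlgebraicGeometry TopologicalSpace IsLocalRing
open MvPolynomial
open Literature.AlgebraicGeometry.Resolution
open AlgebraicGeometry.Scheme.IdealSheafData
open Summit.ResolutionOfSingularities.ResolutionOfSingularities.Cruxes.EquisingularLift.StrataSplit

namespace Summit.ResolutionOfSingularities.ResolutionOfSingularities.Cruxes.EquisingularLiftNat.Sections.Equinodal.CIOfPlanar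

open Summit.ResolutionOfSingularities.ResolutionOfSingularities.Cruxes.EquisingularLiftNat.Sections

variable {k : Type} [Field k] {n : ℕ}

/-! ## §1 (HOST-J) for a linear form -/

/-- **A non-zero linear form has a non-zero constant partial derivative**, hence one outside every relevant homogeneous prime: (HOST-J) for the
hyperplane `V₊(ℓ)` at every point. [folklore; Euler] -/
theorem exists_pderiv_notMem_of_isHomogeneous_one (ℓ : MvPolynomial (Fin (n + 1)) k) (hℓ1 : ℓ.IsHomogeneous 1) (hℓ0 : ℓ ≠ 0) :
    letI := MvPolynomial.gradedAlgebra (σ := Fin (n + 1)) (R := k)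
    ∀ y : Proj (homogeneousSubmodule (Fin (n + 1)) k), ∃ i : Fin (n + 1), ¬ (pderiv i ℓ ∈ y.asHomogeneousIdeal) := by
  letI := MvPolynomial.gradedAlgebra (σ := Fin (n + 1)) (R := k)
  intro y
  -- some partial derivative is non-zero (Euler: `Σ xᵢ ∂ᵢℓ = ℓ ≠ 0`)
  have hex : ∃ i : Fin (n + 1), pderiv i ℓ ≠ 0 := by
    by_contra h
    simp only [not_exists, not_not] at h
    have heuler := hℓ1.sum_X_mul_pderiv
    simp only [h, mul_zero, Finset.sum_const_zero, one_smul] at heuler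
    exact hℓ0 heuler.symm
  obtain ⟨i, hi⟩ := hex
  refine ⟨i, fun hmem => ?_⟩
  -- `∂ᵢℓ` is a non-zero constant, hence a unit — not in the prime `𝔭_y`
  have h0 : (pderiv i ℓ).IsHomogeneous 0 := hℓ1.pderiv
  have hC : pderiv i ℓ = C (coeff 0 (pderiv i ℓ)) := by
    rw [← totalDegree_zero_iff_isHomogeneous, totalDegree_eq_zero_iff_eq_C] at h0
    exact h0
  have hc0 : coeff 0 (pderiv i ℓ) ≠ 0 := fun h => hi (by rw [hC, h, C_0])
  have hunit : IsUnit (pderiv i ℓ) := by rw [hC]; exact (isUnit_iff_ne_zero.mpr hc0).map C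
  haveI : y.asHomogeneousIdeal.toIdeal.IsPrime := y.isPrime
  exact y.isPrime.ne_top (Ideal.eq_top_of_isUnit_mem _ hmem hunit)

/-! ## §2 The planar equation block yields the ci block -/

section Block

variable (ℓ : MvPolynomial (Fin (n + 1)) k) (hℓ1 : ℓ.IsHomogeneous 1) (hℓ0 : ℓ ≠ 0)
  (g : MvPolynomial (Fin (n + 1)) k) (B : Fin (n + 1) → Fin n → k) (r : Fin n → Fin (n + 1))
  (hsq : Squarefree (restrictToHyperplane B g)) (hℓB : restrictToHyperplane B ℓ = 0)
  (hr : Function.Injective r) (hdet : (Matrix.of fun j j' : Fin n => B (r j) j').det ≠ 0)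

include hℓ1 hℓ0 hsq hℓB hr hdet in
/-- **`IsRelPrime ℓ g`** for a non-zero linear `ℓ` with `ℓ|_Π = 0` and `g|_Π` squarefree (`Π` the coordinate hyperplane of `(B, r)`). [folklore] -/
theorem linearForm_isRelPrime_of_squarefree_restrict : IsRelPrime ℓ g := by
  classical
  obtain ⟨a₀, ha₀⟩ := HyperplaneLift.exists_not_mem_range r hr
  obtain ⟨L, N, hL1, hLa₀, hψL, hψσ, hker⟩ := HyperplaneAlg.exists_hyperplane_section B r a₀ hr ha₀ (Ne.isUnit hdet)
  have hL0 : L ≠ 0 := by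
    intro h; rw [h, coeff_zero] at hLa₀; exact zero_ne_one hLa₀
  intro d hdℓ hdg
  obtain ⟨q, hq⟩ := hdℓ
  have hd0 : d ≠ 0 := fun h => hℓ0 (by rw [hq, h, zero_mul])
  have hq0 : q ≠ 0 := fun h => hℓ0 (by rw [hq, h, mul_zero])
  -- read `ℓ = d q` through `ψ`: `0 = ψ d · ψ q`
  have hψ : restrictToHyperplane B d * restrictToHyperplane B q = 0 := by
    change aeval _ d * aeval _ q = 0
    rw [← map_mul, ← hq]; exact hℓB
  rcases mul_eq_zero.mp hψ with hψd | hψq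
  · -- `L ∣ d ∣ g` ⇒ `g|_Π = 0`: absurd
    exfalso
    obtain ⟨m, hm⟩ := (hker d hψd).trans hdg
    have : restrictToHyperplane B g = 0 := by
      change aeval _ g = 0
      rw [hm, map_mul, hψL, zero_mul]
    exact not_squarefree_zero (this ▸ hsq)
  · -- `L ∣ q` ⇒ `deg q ≥ 1` ⇒ `deg d = 0` ⇒ `d` is a unit
    obtain ⟨m, hm⟩ := hker q hψq
    have hm0 : m ≠ 0 := fun h => hq0 (by rw [hm, h, mul_zero])
    have hdegq : 1 ≤ q.totalDegree := by
      rw [hm, totalDegree_mul_of_isDomain hL0 hm0, hL1.totalDegree hL0]; omega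
    have hdeg := totalDegree_mul_of_isDomain hd0 hq0
    rw [← hq, hℓ1.totalDegree hℓ0] at hdeg
    have hdd : d.totalDegree = 0 := by omega
    obtain ⟨u, hu⟩ : ∃ u : k, d = C u := ⟨coeff 0 d, totalDegree_eq_zero_iff_eq_C.mp hdd⟩
    have hu0 : u ≠ 0 := fun h => hd0 (by rw [hu, h, C_0])
    rw [hu]; exact (isUnit_iff_ne_zero.mpr hu0).map C

include hℓ1 hℓ0 hsq hℓB hr hdet in
/-- **`(ℓ, g)` is a RADICAL ideal** for a non-zero linear `ℓ` with `ℓ|_Π = 0` and `g|_Π` squarefree: `(ℓ, g) = (L, σ(g|_Π))`, which is the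
preimage of the radical `(g|_Π)` (✓ `HyperplaneAlg.isRadical_pair_of_isRadical`). [folklore] -/
theorem isRadical_span_linearForm_pair_of_squarefree_restrict : (Ideal.span {ℓ, g}).IsRadical := by
  classical
  obtain ⟨a₀, ha₀⟩ := HyperplaneLift.exists_not_mem_range r hr
  obtain ⟨L, N, hL1, hLa₀, hψL, hψσ, hker⟩ := HyperplaneAlg.exists_hyperplane_section B r a₀ hr ha₀ (Ne.isUnit hdet)
  let ψ : MvPolynomial (Fin (n + 1)) k →+* MvPolynomial (Fin n) k :=
    (aeval fun a : Fin (n + 1) => ∑ j : Fin n, C (B a j) * X j).toRingHom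
  let σ : MvPolynomial (Fin n) k → MvPolynomial (Fin (n + 1)) k :=
    fun G => aeval (fun i : Fin n => ∑ j : Fin n, C (N i j) * X (r j)) G
  have hψL' : ψ L = 0 := hψL
  have hψσ' : ∀ G, ψ (σ G) = G := fun G => hψσ G
  have hker' : ∀ f, ψ f = 0 → L ∣ f := fun f hf => hker f hf
  -- `(L, σ(g|_Π))` is radical
  have hrad := HyperplaneAlg.isRadical_pair_of_isRadical ψ σ L hψL' hψσ' hker' (restrictToHyperplane B g)
    (HyperplaneAlg.isRadical_span_singleton_of_squarefree _ hsq)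
  -- `ℓ = u L`, `u ≠ 0`
  obtain ⟨u, hu0, hℓu⟩ := HostNormalForm.exists_C_mul_eq_of_dvd hL1 hℓ1 hℓ0 (hker ℓ hℓB)
  -- `g = σ (ψ g) + L m`
  obtain ⟨m, hm⟩ := HyperplaneAlg.dvd_sub_section ψ σ L hψσ' hker' g
  have hψg : ψ g = restrictToHyperplane B g := rfl
  have hg : g = σ (restrictToHyperplane B g) + L * m := by rw [← hψg, ← hm]; ring
  -- the two pairs span the same ideal
  have h1 : Ideal.span {L, g} = Ideal.span {L, σ (restrictToHyperplane B g)} := by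
    conv_lhs => rw [hg]
    exact Ideal.span_pair_add_left_mul L (σ (restrictToHyperplane B g)) m
  have h2 : Ideal.span {ℓ, g} = Ideal.span {L, g} := by
    have hCu : IsUnit (C u : MvPolynomial (Fin (n + 1)) k) := (isUnit_iff_ne_zero.mpr hu0).map C
    rw [hℓu, Ideal.span_insert, Ideal.span_singleton_mul_left_unit hCu, ← Ideal.span_insert]
  rw [h2, h1]
  exact hrad

end Block

/-! ## §3 The census lemma -/

/-- ★ **Σ1 ⊂ Σ5a BY TEXT: a ν3ᵈ move is a ν3ᶜⁱ move.**  For the blob's hyperplane host `V₊(ℓ)` (`ℓ` homogeneous of degree `1`, `ℓ ≠ 0`), every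
instance of `ReachDirectPlanarNose₂ k n ℓ T₁ F₉ β T₉ E₉` (✓ p703167) is an instance of `ReachDirectCINose₂ k n T₁ F₉ β T₉ E₉` (✓ p705365) with the same
`Z`, round and tail and the ci block `(1, e, ℓ, g)`.  [OURS · L1 W4.5b · census lemma for the 47th's letters; pure algebra + logic; counted 0;
EL♮(3) NOT proved] -/
theorem reachDirectCINose₂_of_reachDirectPlanarNose₂ (ℓ : MvPolynomial (Fin (n + 1)) k) (hℓ1 : ℓ.IsHomogeneous 1) (hℓ0 : ℓ ≠ 0)
    (T₁ : Set (Literature.AlgebraicGeometry.Motives.projectiveSpace n k).left) (F₉ : Scheme.{0})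
    (β : F₉ ⟶ (Literature.AlgebraicGeometry.Motives.projectiveSpace n k).left) (T₉ E₉ : Set F₉)
    (h : ReachDirectPlanarNose₂ k n ℓ T₁ F₉ β T₉ E₉) : ReachDirectCINose₂ k n T₁ F₉ β T₉ E₉ := by
  obtain ⟨hE₉, Z, hZ, hZT, hTZ, hZinf, -, -, hZdim, -, -, -, hN1, ⟨e, g, B, r, hg, hsq, hZeq, hℓB, hr, hdet⟩,
    F₃, υ', hυ', γ', E', Es', Ns', K', htail, hβ⟩ := h
  refine ⟨hE₉, Z, hZ, hZT, hTZ, hZinf, hZdim, hN1, ⟨1, e, ℓ, g, hℓ1, hg, hZeq,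
    linearForm_isRelPrime_of_squarefree_restrict ℓ hℓ1 hℓ0 g B r hsq hℓB hr hdet,
    (by rintro rfl; exact not_squarefree_zero (by simpa only [restrictToHyperplane, map_zero] using hsq)),
    isRadical_span_linearForm_pair_of_squarefree_restrict ℓ hℓ1 hℓ0 g B r hsq hℓB hr hdet, ?_⟩,
    F₃, υ', hυ', γ', E', Es', Ns', K', htail, hβ⟩
  intro y _
  exact exists_pderiv_notMem_of_isHomogeneous_one ℓ hℓ1 hℓ0 y

end Summit.ResolutionOfSingularities.ResolutionOfSingularities.Cruxes.EquisingularLiftNat.Sections.Equinodal.CIOfPlanar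

end
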